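import Summits.ABC.IUTFork.Repair.ObstructionSS14
import Summits.ABC.IUTFork.Repair.ObstructionSS2
import Summits.ABC.IUTFork.Cor312PinnedSetting
import Summits.ABC.IUTFork.Cor312NaiveThm311
import HarnessLib

/-!
# IUT REPAIR branch, sub-cell B5 — ESCAPE CENSUS VI(b): the flip model's DATA, its typed Theorem 3.11, the PINNED SETTING, and S

MODEL DATA + proofs (D-0012; toys over abc-iut-c312-7's one-place `toyIndex`, `l⋇ = 2`; no `Prop` fact, nothing asserted about print) of the abc-iut
cell's IUT REPAIR branch (REPAIR-SPEC §4 row RP-S02, door (b); rung LADDER-ABC:A2.RP ⊆ A2.B), seat abc-iut-rp-s2 (gen 2). Part (b) of three: the bed is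
`ObstructionSS14` (flip shells, tensor log-shell `tShell`, flip family; see its docstring for WHY); the results are `ObstructionSS18`. TAKES NO SIDE on
[IUTchIII] Cor. 3.12 or on any author; typed ≠ proved; instantiated ≠ endorsed. Frozen files imported, never edited.

THE MODEL. VOLUMES (`vol`): the Θ-point `{e₀^{⊗(j+1)}}` has log-volume `−j²`, every other point `−1` (so the q-point `{e₁^{⊗(j+1)}}` has `−1`), every
larger region — in particular the tensor log-shell `tShell j` — has `0`; ADMISSIBLE regions `𝕄(−)`: the tensor log-shell and its points; the volume is
MONOTONE on them (`vol_mono`, Prop. 3.9 (i)) and NOT translation-rigid under the flip — the model's single departure from Step (x) (p. 181), see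
`ObstructionSS18`. DATA (a)(b)(c) of every vertical line (`fData`, [IUTchIII] Thm. 3.11 (i)): integral structure `tShell`, splitting monoid the single
Θ-datum `(e₀^{⊗(j+1)})_{j ∈ 𝔽_l^⋇}` (`fPsi`); q-pilot Kummer datum `fqK` the single q-datum `(e₁^{⊗(j+1)})_j`; COLUMNS (`fColumn`, Thm. 3.11 (ii)): identity
Kummer transport (so (ii)(b) `KummerB` by `rfl`), Frobenioid objects abc-iut-w5-d247's tagged copies of `ℤ` (`FrobObj`/`kum`), Θ-pilot of index `1`;
link data w5-d247's `naiveLink`; **`fFull_statement`: the typed Theorem 3.11 (i) ∧ (ii) ∧ (iii) HOLDS** (`FullSituation.Statement`). THE PINNED SETTING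
`fSetting` (column `n = 0`): abc-iut-w4-d101's honest object side `pinSig` (p418585) verbatim, pilots of exponent `1`; hull frame `fFrame j` = {tensor
log-shell, q-point}, «relatively compact» = inside the tensor log-shell; GLUE: Θ-pilot ↦ Θ-point, q-pilot ↦ q-point at labels `j ≥ 1`, both ↦ `tShell 0`
at the junk label `0` (read by nothing in Cor. 3.12). THE REGION READING `rho` = «the set of `j`-components of the datum» (`tShell 0` at label `0`),
EQUIVARIANT FOR THE WHOLE GROUP `⟨(Ind1) ∪ (Ind2)⟩` (`rho_equivariant`: componentwise action at `j ≥ 1`, `image_tShell_of_mem_closure` at `0`). PROVED: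
the three pins `f_pinnedRegions3` ((pΘ) with (hρ), (pq′), (pL)), `f_kummerB`, and **`f_S` — S = `PilotKummerIndRelated` HOLDS through a GENUINE
(Ind2)-move** (the flip family carries `rho(Ψ)` onto `rho(qK)` in every packet, `flipFam_carries`; abc-iut-rp-s2's `ObstructionSS2.S_of_rescaling`).
S. Mochizuki, *Inter-universal Teichmüller theory III*, kurims manuscript (May 2020) = `paper:url-4b091feeb646` (cell render); Cor. 3.12 statement
p. 173 l. 41 – p. 174 l. 19, Thm. 3.11 pp. 153–158. [cite: ScholzeStix2018, §2.2 pp. 9–10] [claim: Mochizuki2012, status: disputed] Standard axioms only.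
-/

noncomputable section

open Set

namespace Summit.ABC.IUTFork.Repair.ObstructionSS16

open Thm311 Cor312 Cor312Vol Cor312.Checks Cor312.IdentifiedNonVacuity Cor312Vol.PinnedWitness Cor312Vol.NaiveWitness
  Literature.IUT.LogThetaLattice ObstructionSS14

/-! ## 4. Volumes, admissible regions, the data of every vertical line, the columns, the full situation -/

variable (j vQ)

open scoped Classical in
/-- **The LOG-VOLUME of the model** at label `j`: the Θ-point `{e₀^{⊗(j+1)}}` has volume `−j²`, every other point volume `−1`
(in particular the q-point `{e₁^{⊗(j+1)}}`), every larger region (in particular the tensor log-shell) volume `0`. A monotone set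
function which is NOT translation-rigid under the cflip: the model's one departure from Step (x). MODEL DATA. [claim: Mochizuki2012, status: disputed] -/
def vol (A : Set (flipShells.Packet j vQ)) : ℝ :=
  if A ⊆ {aVec j vQ} then -(((j : ℕ) : ℝ) ^ 2) else if ∃ x, A ⊆ {x} then -1 else 0

/-- `μ({Θ-vector}) = −j²`. [folklore] -/
theorem vol_aVec : vol j vQ {aVec j vQ} = -(((j : ℕ) : ℝ) ^ 2) := by
  unfold vol; rw [if_pos Set.Subset.rfl]

/-- `μ({x}) = −1` for every other point. [folklore] -/
theorem vol_singleton_of_ne {x : flipShells.Packet j vQ} (hx : x ≠ aVec j vQ) : vol j vQ {x} = -1 := by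
  unfold vol
  rw [if_neg (fun h => hx (Set.singleton_subset_singleton.mp h)), if_pos ⟨x, Set.Subset.rfl⟩]

/-- `μ({q-vector}) = −1`. [folklore] -/
theorem vol_bVec : vol j vQ {bVec j vQ} = -1 := vol_singleton_of_ne j vQ (aVec_ne_bVec j vQ).symm

/-- `μ(C_j) = 0`. [folklore] -/
theorem vol_tShell : vol j vQ (tShell j vQ) = 0 := by
  unfold vol
  rw [if_neg (not_tShell_subset_singleton j vQ _), if_neg]
  rintro ⟨x, hx⟩
  exact not_tShell_subset_singleton j vQ x hx

/-- A subset of a point of volume has volume at most `0`… precisely: every point has NONPOSITIVE volume. [folklore] -/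
theorem vol_singleton_le (x : flipShells.Packet j vQ) : vol j vQ {x} ≤ 0 := by
  by_cases hx : x = aVec j vQ
  · rw [hx, vol_aVec]; exact neg_nonpos.mpr (sq_nonneg _)
  · rw [vol_singleton_of_ne j vQ hx]; norm_num

variable {j vQ}

/-- The Θ-DATUM: the star-vector of Θ-vectors `(e₀^{⊗(j+1)})_{j ∈ 𝔽_l^⋇}`. MODEL DATA. [claim: Mochizuki2012, status: disputed] -/
def thetaVec (v : toyIndex.V) : flipShells.StarPacket v := fun j => aVec j.1 (toyIndex.over v)

/-- The q-DATUM: the star-vector of q-vectors `(e₁^{⊗(j+1)})_{j ∈ 𝔽_l^⋇}`. MODEL DATA. [claim: Mochizuki2012, status: disputed] -/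
def qVec (v : toyIndex.V) : flipShells.StarPacket v := fun j => bVec j.1 (toyIndex.over v)

/-- The SPLITTING MONOID `Ψ_v` of the model: the single Θ-datum. MODEL DATA. [claim: Mochizuki2012, status: disputed] -/
def fPsi (v : toyIndex.V) (_ : v ∈ toyIndex.Vbad) : Set (flipShells.StarPacket v) := {thetaVec v}

/-- The q-pilot's Kummer datum `fqK` of the model: the single q-datum. MODEL DATA. [claim: Mochizuki2012, status: disputed] -/
def fqK (v : toyIndex.V) (_ : v ∈ toyIndex.Vbad) : Set (flipShells.StarPacket v) := {qVec v}

/-- **Data (a)(b)(c) of every vertical line** ([IUTchIII] Thm. 3.11 (i)) of the model: integral structure the tensor log-shell, admissible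
regions and log-volume as above, splitting monoid the Θ-datum. MODEL DATA. [claim: Mochizuki2012, status: disputed] -/
def fData : MRData flipShells where
  shellPk := fun j vQ => tShell j vQ
  shellSub := fun j v => tShell j (toyIndex.over v)
  Adm := fun j vQ A => A = tShell j vQ ∨ ∃ x ∈ tShell j vQ, A = {x}
  logvol := vol
  Ψ := fPsi
  act := fun _ _ _ => LinearMap.id
  Mmod := fun _ => Set.univ

/-- **ADMISSIBLE REGIONS** `𝕄(𝓘^ℚ(−))` of the model: the tensor log-shell and its points (unfolding lemma). [folklore] -/
theorem adm_iff (j : toyIndex.Label) (vQ : toyIndex.VQ) (A : Set (flipShells.Packet j vQ)) :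
    fData.Adm j vQ A ↔ A = tShell j vQ ∨ ∃ x ∈ tShell j vQ, A = {x} := Iff.rfl

/-- The tensor log-shell is admissible. [folklore] -/
theorem adm_tShell (j : toyIndex.Label) (vQ : toyIndex.VQ) : fData.Adm j vQ (tShell j vQ) := Or.inl rfl

/-- A point of the tensor log-shell is admissible. [folklore] -/
theorem adm_singleton (j : toyIndex.Label) (vQ : toyIndex.VQ) {x : flipShells.Packet j vQ} (hx : x ∈ tShell j vQ) :
    fData.Adm j vQ {x} := Or.inr ⟨x, hx, rfl⟩

/-- **The log-volume is MONOTONE on admissible regions** (Prop. 3.9 (i)). [folklore] -/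
theorem vol_mono (j : toyIndex.Label) (vQ : toyIndex.VQ) {A B : Set (flipShells.Packet j vQ)} (hA : fData.Adm j vQ A)
    (hB : fData.Adm j vQ B) (hAB : A ⊆ B) : vol j vQ A ≤ vol j vQ B := by
  rcases hB with rfl | ⟨y, -, rfl⟩
  · rw [vol_tShell]
    rcases hA with rfl | ⟨x, -, rfl⟩
    · rw [vol_tShell]
    · exact vol_singleton_le j vQ x
  · rcases hA with rfl | ⟨x, -, rfl⟩
    · exact absurd hAB (not_tShell_subset_singleton j vQ y)
    · rw [Set.singleton_subset_singleton.mp hAB]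

/-- (c)'s global realified Frobenioids: one object, degree `0`, region the tensor log-shell. MODEL DATA. [claim: Mochizuki2012, status: disputed] -/
def fDegrees (j : toyIndex.LabelStar) : GlobalDegrees flipShells j where
  ObjMOD := Unit
  Objmod := Unit
  natIso := Equiv.refl Unit
  deg := fun _ => 0
  region := fun _ vQ => tShell j.1 vQ

/-- The situation (all vertical lines carry the same data; an `abbrev`, so `fSituation.L` reduces to `flipShells`). MODEL DATA.
[claim: Mochizuki2012, status: disputed] -/
abbrev fSituation : Situation toyIndex where
  L := flipShells
  D := fun _ => fData
  G := fun _ j => fDegrees j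

/-- **The column data** ([IUTchIII] Thm. 3.11 (ii)): identity Kummer transport at every `(n, m)` (so (ii)(b) holds by `rfl`), unit-group and
ball images the tensor log-shell, Frobenioid objects abc-iut-w5-d247's tagged copies of `ℤ`, Θ-pilot the object of index `1`. MODEL DATA.
[claim: Mochizuki2012, status: disputed] -/
def fColumn : Column flipShells where
  frobAdm := fun _ => fData.Adm
  frobLogvol := fun _ => vol
  frobΨ := fun _ => fPsi
  frobMmod := fun _ _ => Set.univ
  unitImage := fun _ _ j vQ => tShell j vQ
  ballImage := fun _ j vQ => tShell j vQ
  ObjLGP := ℤ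
  frobObjLGP := FrobObj
  kumLGP := kum
  ObjLgp := ℤ
  frobObjLgp := FrobObj
  kumLgp := kum
  thetaPilot := fun m => ⟨(1, m), rfl⟩

/-- **The full situation of the model** (link data: abc-iut-w5-d247's `naiveLink`). MODEL DATA. [claim: Mochizuki2012, status: disputed] -/
abbrev fFull : FullSituation toyIndex where
  toSituation := fSituation
  col := fun _ => fColumn
  link := naiveLink

/-- Over the one-place index the sub-packet `𝓘^ℚ(^{S^±_{j+1},j};𝒟⊢_v)` is the whole packet. [folklore] -/
theorem subPacket_eq_top (j : toyIndex.Label) (v : toyIndex.V) : flipShells.SubPacket j v = ⊤ := by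
  haveI : Subsingleton toyIndex.V := inferInstanceAs (Subsingleton Unit)
  refine top_unique fun x _ => ?_
  have hx : x ∈ Submodule.span ℚ (Set.range (PiTensorProduct.tprod ℚ
      (s := fun _ : toyIndex.Caps j => flipShells.Packet1 (toyIndex.over v)))) := by
    rw [PiTensorProduct.span_tprod_eq_top]; trivial
  refine Submodule.span_mono ?_ hx
  rintro _ ⟨y, rfl⟩
  exact ⟨y, fun w hw => absurd (Subsingleton.elim _ _) hw, rfl⟩

/-- **THE TYPED THEOREM 3.11 (i) ∧ (ii) ∧ (iii) HOLDS in the model** (`FullSituation.Statement`). [folklore] -/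
theorem fFull_statement : fFull.Statement := by
  have hI : fFull.PartI := by
    refine ⟨fun n v hv x _ j => ?_, fun n j J => ⟨fun vQ => Or.inl rfl, Set.toFinite _, ?_⟩, fun _ _ => rfl⟩
    · show x j ∈ flipShells.SubPacket j.1 v
      rw [subPacket_eq_top]; trivial
    · show (0 : ℝ) = ∑ᶠ vQ, vol j.1 vQ (tShell j.1 vQ)
      simp only [vol_tShell, finsum_zero]
  refine ⟨hI, fun n => ?_, ?_⟩
  · exact (Column.partII_iff _ _).2 ⟨fun m j vQ A hA => ⟨hA, rfl⟩, fun _ _ _ => rfl, fun _ _ => rfl,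
      fun _ _ _ _ _ => Set.Subset.rfl, fun _ _ _ h => absurd trivial h⟩
  · refine ⟨naiveLink.partIIIa_holds, naiveLink.partIIIb_holds, ?_, ?_, fFull.evalCompatUpToInd_of_multiradialCompat hI.2.2⟩
    · refine naiveLink.partIIIc_of_full (fun _ => rfl) fun n m => ?_
      rintro _ ⟨a, rfl⟩
      show unitIso a ≪≫ unitIso ((-1) ^ m.natAbs) = unitIso ((-1) ^ m.natAbs) ≪≫ unitIso a
      rw [unitIso_trans, unitIso_trans, mul_comm]
    · intro n m; exact Thm311.PolyIsoCalc.stabilized_full _ _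

/-- Thm. 3.11 (ii)(b) for every column of the model (identity transport: `rfl`). [folklore] -/
theorem f_kummerB (n : ℤ) : (fFull.col n).KummerB (fFull.D n) := fun _ _ _ => rfl

/-! ## 5. The pinned setting: the frame `{C_j, {q-vector}}`, honest glue, the region reading `rho`, the pins, S -/

variable (j vQ)

/-- **The HULL FRAME of the model** at label `j`: hull-sets the tensor log-shell `C_j` and the q-point `{e₁^{⊗(j+1)}}`; «relatively compact» =
inside the tensor log-shell; every bounded region admits its hull. MODEL DATA. [claim: Mochizuki2012, status: disputed] -/
def fFrame : HullFrame (flipShells.Packet j vQ) where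
  Hul := {H | H = tShell j vQ ∨ H = {bVec j vQ}}
  IsBounded := fun U => U ⊆ tShell j vQ
  HasHull := fun _ => True
  hul_bounded := by
    rintro H (rfl | rfl)
    · exact Set.Subset.rfl
    · exact Set.singleton_subset_iff.2 (bVec_mem_tShell j vQ)
  bounded_mono := fun _ _ h h' => h.trans h'
  exists_hul := fun U hU => ⟨tShell j vQ, Or.inl rfl, hU⟩
  hull_mem := fun U hU _ => by
    by_cases hb : U ⊆ {bVec j vQ}
    · refine Or.inr (Set.Subset.antisymm (Set.sInter_subset_of_mem ⟨Or.inr rfl, hb⟩) (Set.subset_sInter ?_))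
      rintro H ⟨(rfl | rfl), -⟩
      · exact Set.singleton_subset_iff.2 (bVec_mem_tShell j vQ)
      · exact Set.Subset.rfl
    · refine Or.inl (Set.Subset.antisymm (Set.sInter_subset_of_mem ⟨Or.inl rfl, hU⟩) (Set.subset_sInter ?_))
      rintro H ⟨(rfl | rfl), hUH⟩
      · exact Set.Subset.rfl
      · exact absurd hUH hb

variable {j vQ}

/-- **The PINNED SETTING of the model** (column `n = 0`): abc-iut-w4-d101's honest object side (`pinSig`, pilots of exponent `1`, p418585) verbatim;
frames `fFrame`; GLUE: the Θ-pilot's `(n,m)`-Kummer image at a label `j ≥ 1` is the Θ-point `{e₀^{⊗(j+1)}}`, the q-pilot's image the q-point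
`{e₁^{⊗(j+1)}}`, both the tensor log-shell at the junk label `0`. MODEL DATA. [claim: Mochizuki2012, status: disputed] -/
def fSetting : Setting fSituation where
  n := 0
  HT := ℤ × ℤ
  LogLink := fun _ _ => Unit
  IsFull := fun _ => True
  lattice :=
    { theater := fun n m => (n, m)
      distinct := fun p q h => by simpa using h
      logLink := fun _ _ => ()
      logLink_full := fun _ _ => trivial }
  Frd := Unit
  IsoF := fun _ _ => Unit
  Ob := fun _ => ℤ
  realify := id
  Strip := Unit
  IsoS := fun _ _ => Unit
  M := fun _ _ => ExpMonoid
  sig := pinSig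
  split := { Msplit := fun _ _ => ⊤, exists_gen := fun _ _ => ⟨⟨gen, trivial⟩, top_gen_isGenerator⟩ }
  ObΔ := ℤ
  N := fun _ _ => ExpMonoid
  qData :=
    { q := fun _ _ => gen
      q_gen := fun _ _ => gen_isGenerator
      objOf := fun x => (expOf (x () (Set.mem_univ ())) : ℤ) }
  frame := fun j vQ => fFrame j vQ
  hul_adm := fun j vQ H hH => by
    rcases hH with rfl | rfl
    · exact adm_tShell j vQ
    · exact adm_singleton j vQ (bVec_mem_tShell j vQ)
  thetaRegionOf := fun _ _ j vQ => if j = 0 then tShell j vQ else {aVec j vQ}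
  qRegionOf := fun _ j vQ => if j = 0 then tShell j vQ else {bVec j vQ}
  qRegion_mem := fun j vQ => by
    by_cases h : j = 0
    · exact Or.inl (by rw [if_pos h])
    · exact Or.inr (by rw [if_neg h])
  qSupport_finite := fun _ => Set.toFinite _

/-- The Θ-pilot object is the lgp-object of exponent `1`. [folklore] -/
theorem fSetting_thetaPilot : fSetting.thetaPilot = (1 : ℤ) :=
  congrArg (Nat.cast : ℕ → ℤ)
    (expOf_eq_one_of_isGenerator_top (Classical.choose_spec (fSetting.split.exists_gen () (Set.mem_univ ()))))

/-- The q-pilot object is the `△`-object of exponent `1`. [folklore] -/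
theorem fSetting_qPilot : fSetting.qPilot = (1 : ℤ) := rfl

/-- The `(n,m)`-Kummer image of the Θ-pilot: `C_0` at label `0`, the Θ-point at `j ≥ 1`. [folklore] -/
theorem fSetting_thetaRegion (m : ℤ) (j : toyIndex.Label) (vQ : toyIndex.VQ) :
    fSetting.thetaRegion m j vQ = if j = 0 then tShell j vQ else {aVec j vQ} := rfl

/-- The (Ind3)-enlarged Θ-region is the same (constant in `m`). [folklore] -/
theorem fSetting_thetaRegion3 (j : toyIndex.Label) (vQ : toyIndex.VQ) :
    fSetting.thetaRegion3 j vQ = if j = 0 then tShell j vQ else {aVec j vQ} := by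
  unfold Setting.thetaRegion3
  simp only [fSetting_thetaRegion, Set.iUnion_const]

/-- The image of the q-pilot: `C_0` at label `0`, the q-point at `j ≥ 1`. [folklore] -/
theorem fSetting_qRegion (j : toyIndex.Label) (vQ : toyIndex.VQ) :
    fSetting.qRegion j vQ = if j = 0 then tShell j vQ else {bVec j vQ} := rfl

/-- **The REGION READING `rho`**: the tensor log-shell at label `0`; at `j ≥ 1` the set of `j`-components of the datum (the natural,
component-wise reading). MODEL DATA. [claim: Mochizuki2012, status: disputed] -/
def rho (X : ∀ v : toyIndex.V, v ∈ toyIndex.Vbad → Set (flipShells.StarPacket v)) (j : toyIndex.Label) (vQ : toyIndex.VQ) :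
    Set (flipShells.Packet j vQ) :=
  if h : j = 0 then tShell j vQ else {y | ∃ f ∈ X () trivial, f ⟨j, h⟩ = y}

/-- `rho` at label `0`. [folklore] -/
theorem rho_zero (X : ∀ v : toyIndex.V, v ∈ toyIndex.Vbad → Set (flipShells.StarPacket v)) (vQ : toyIndex.VQ) :
    rho X 0 vQ = tShell 0 vQ := by
  simp [rho]

/-- `rho` of a one-element datum at a nonzero label: the singleton of its `j`-component. [folklore] -/
theorem rho_singleton {j : toyIndex.Label} (h : j ≠ 0) (f : flipShells.StarPacket ()) (vQ : toyIndex.VQ) :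
    rho (fun _ _ => {f}) j vQ = {f ⟨j, h⟩} := by
  unfold rho
  rw [dif_neg h]
  ext y
  simp only [Set.mem_singleton_iff, exists_eq_left, Set.mem_setOf_eq]
  exact eq_comm

/-- `rho(Ψ)` = the Θ-point at `j ≥ 1`, `C_0` at label `0`. [folklore] -/
theorem rho_fPsi (j : toyIndex.Label) (vQ : toyIndex.VQ) : rho fPsi j vQ = if j = 0 then tShell j vQ else {aVec j vQ} := by
  by_cases h : j = 0
  · subst h; rw [rho_zero, if_pos rfl]
  · rw [if_neg h]; exact rho_singleton h (thetaVec ()) vQ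

/-- `rho(fqK)` = the q-point at `j ≥ 1`, `C_0` at label `0`. [folklore] -/
theorem rho_fqK (j : toyIndex.Label) (vQ : toyIndex.VQ) : rho fqK j vQ = if j = 0 then tShell j vQ else {bVec j vQ} := by
  by_cases h : j = 0
  · subst h; rw [rho_zero, if_pos rfl]
  · rw [if_neg h]; exact rho_singleton h (qVec ()) vQ

/-- **(hρ) FOR THE WHOLE INDETERMINACY GROUP**: every `Φ ∈ ⟨(Ind1) ∪ (Ind2)⟩` satisfies `rho(Φ·X) = Φ '' rho(X)` (at label `0` because `Φ`
permutes the tensor log-shell; at `j ≥ 1` because taking `j`-components commutes with `Φ`). [folklore] -/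
theorem rho_equivariant {Φ : flipShells.PacketAut}
    (hΦ : Φ ∈ Subgroup.closure (flipShells.Ind1Family ∪ flipShells.Ind2Family))
    (X : ∀ v : toyIndex.V, v ∈ toyIndex.Vbad → Set (flipShells.StarPacket v)) (j : toyIndex.Label) (vQ : toyIndex.VQ) :
    rho (fun v hv => flipShells.starAut Φ v '' X v hv) j vQ = Φ j vQ '' rho X j vQ := by
  obtain rfl : vQ = toyIndex.over () := rfl
  by_cases h : j = 0
  · subst h
    rw [rho_zero, rho_zero, image_tShell_of_mem_closure hΦ]
  · unfold rho
    rw [dif_neg h, dif_neg h]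
    ext y
    simp only [Set.mem_setOf_eq, Set.mem_image, exists_exists_and_eq_and]
    rfl

/-- **THE Θ-PIN** (pΘ) with (hρ) for the whole group. [claim: Mochizuki2012, status: disputed] -/
theorem f_thetaPinned : ThetaPinned fFull.toLatticeSituation fSetting rho :=
  ⟨fun Φ hΦ X j vQ => rho_equivariant hΦ X j vQ, fun m j vQ => by rw [fSetting_thetaRegion]; exact (rho_fPsi j vQ).symm⟩

/-- **THE q-PIN** (pq′). [claim: Mochizuki2012, status: disputed] -/
theorem f_qPinned : QPinned fFull.toLatticeSituation fSetting rho fqK := fun j vQ => by rw [fSetting_qRegion, rho_fqK]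

/-- **(pL) — the link pin** (identity of exponents; pilots of exponent `1`). [folklore] -/
theorem f_linkPinned : LinkPinned fFull.toLatticeSituation fSetting :=
  ⟨Equiv.refl ℤ, by rw [fSetting_thetaPilot, fSetting_qPilot]; rfl⟩

/-- **`PinnedRegions3` HOLDS in the model.** [claim: Mochizuki2012, status: disputed] -/
theorem f_pinnedRegions3 : PinnedRegions3 fFull.toLatticeSituation fSetting rho fqK :=
  ⟨⟨f_thetaPinned, f_qPinned⟩, f_linkPinned⟩

/-- **The cflip family CARRIES `rho(Ψ)` ONTO `rho(fqK)` in every packet** (`{e₀^{⊗}} ↦ {e₁^{⊗}}`; `C_0 ↦ C_0`). [folklore] -/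
theorem flipFam_carries (j : toyIndex.Label) (vQ : toyIndex.VQ) : rho fqK j vQ = flipFam j vQ '' rho fPsi j vQ := by
  rw [rho_fPsi, rho_fqK]
  by_cases h : j = 0
  · rw [if_pos h, if_pos h, image_tShell_of_mem_closure flipFam_mem_closure]
  · rw [if_neg h, if_neg h, Set.image_singleton, flipFam_aVec]

/-- **S HOLDS**: `PilotKummerIndRelated` at the model, through a GENUINE (Ind2)-move (`ObstructionSS2.S_of_rescaling`). [claim: Mochizuki2012, status: disputed] -/
theorem f_S : PilotKummerIndRelated fFull.toLatticeSituation fSetting rho fqK :=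
  ObstructionSS2.S_of_rescaling fFull.toLatticeSituation fSetting rho fqK f_thetaPinned flipFam_mem_closure flipFam_carries

end Summit.ABC.IUTFork.Repair.ObstructionSS16

end
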